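import Summits.Ventures.LatticeQCDFlow.Exactness.IMHCoupledUnbiasedEstimatorMSE
import HarnessLib

/-!
# No free lunch: the coupled unbiased estimator's mean-square error is one equilibrium draw's variance FROM BOTH SIDES,
# `|E(H_{k,N} − π f)² − Var_π f| ≤ (1 − A)^k (c − a)² (2W² + W + 1)`

HONEST FRAMING: exact (Metropolis-corrected) sampling algorithms for lattice gauge theory;
figures of merit are autocorrelation/cost numbers at stated couplings and volumes; no
continuum-physics claim.

Venture `LatticeQCDFlow` (cell pub-lqcd), topic `Exactness`; FANOUT row 30 (lean-1, GEN-37).  NEW WORK of the cell,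
general state space; sequel to `Exactness/IMHCoupledUnbiasedEstimatorMSE` (this generation, the UPPER envelope).  Setting as there
(`K = indepMH q w`, `W = w(x₀) = 1/A`, `r = 1 − A`; CRN pair kernel `K̂`; `a ≤ f ≤ c` measurable; `H_{k,N} = f(Y_k) + Σ_{n<N} D_{k+n}`,
`μ₂ = μ̂₀∘snd⁻¹`, `Var_π f = ∫(f − π f)² dπ`).  Removing the burn-in bias by coupling does NOT reduce the variance below one draw's:

* **`crnLag_truncated_sq_ge`** — from every initial coupling, `E(H_{k,N} − π f)² ≥ ∫(f − π f)² d(μ₂K^k) − 2r^k(c − a)²W`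
  (pointwise `(X + S)² ≥ X² − 2|X|·Σ|D|`, the cross term of the MSE file);
* **`crnLag_truncated_sq_ge_variance`** — with the any-start lower envelope `∫(f − π f)² d(μ₂K^k) ≥ (1 − r^k)Var_π f`:
  `E(H_{k,N} − π f)² ≥ (1 − r^k)·Var_π f − 2r^k(c − a)²W`;
* **`crnLag_truncated_sq_sub_variance_abs_le`** — THE TWO-SIDED CERTIFICATE: `|E(H_{k,N} − π f)² − Var_π f| ≤ r^k·(c − a)²·(2W² + W + 1)`
  for every `k`, `N` and every initial coupling (upper side = the MSE file; `Var_π f ≤ (c − a)²`); hence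
  (**`crnLag_truncated_sq_sub_variance_abs_le_of_log_le`**) `log((2W² + W + 1)/ε) ≤ k·A ⇒ |E(H_{k,N} − π f)² − Var_π f| ≤ ε(c − a)²`.
Reading (gauge files): one coupled pair is worth EXACTLY one equilibrium draw up to `(1 − A)^k × const` — precision comes only from
replicas (`IMHCoupledEstimatorReplicas`: `/R`) or from time averaging (`IMHCoupledTimeAverageEstimator`: `/L` with the factor
`2W − 1`), never from the coupling itself.
NOT CLAIMED: the exact variance; the sign of `E(H_{k,N} − π f)² − Var_π f`; anything for unbounded `f`.  No `sorry`, no new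
definitions, nothing cited as a fact.
-/

noncomputable section

namespace Summit.Ventures.LatticeQCDFlow.Exactness

open MeasureTheory ProbabilityTheory Function Finset
open scoped ENNReal unitInterval
open Summit.Ventures.LatticeQCDFlow.Scoring

variable {Ω : Type*} [MeasurableSpace Ω] {q : Measure Ω} [IsProbabilityMeasure q] {w : Ω → ℝ}

/-- **THE LOWER SIDE**: `w` measurable (a `Fact`), positive, normalised, maximal at `x₀` (`W = w(x₀)`, `r = 1 − 1/W`); `K̂` a CRN
pair kernel; `a ≤ f ≤ c` measurable; any initial coupling `μ̂₀`; every `k`, `N`: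
`∫(f − π f)² d(μ₂K^k) − 2r^k(c − a)²W ≤ E(f(Y_k) + Σ_{n<N} D_{k+n} − π f)²`. [ours] -/
theorem crnLag_truncated_sq_ge [Fact (Measurable w)] (hw0 : ∀ y, 0 < w y) {x₀ : Ω} (hmax : ∀ y, w y ≤ w x₀)
    [IsProbabilityMeasure (q.withDensity fun y => ENNReal.ofReal (w y))]
    (Khat : Kernel (Ω × Ω) (Ω × Ω)) [IsMarkovKernel Khat]
    (hK : ∀ z : Ω × Ω, Khat z = (q.prod (volume : Measure unitInterval)).map (fun p : Ω × unitInterval =>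
      ((if (p.2 : ℝ) * w z.1 ≤ w p.1 then p.1 else z.1), (if (p.2 : ℝ) * w z.2 ≤ w p.1 then p.1 else z.2))))
    (μ₀ : Measure (Ω × Ω)) [IsProbabilityMeasure μ₀] {f : Ω → ℝ} (hf : Measurable f) {a c : ℝ}
    (ha : ∀ x, a ≤ f x) (hc : ∀ x, f x ≤ c) (k N : ℕ) :
    ∫ y, (f y - ∫ x, f x ∂(q.withDensity fun y => ENNReal.ofReal (w y))) ^ 2
          ∂((fun m : Measure Ω => m.bind (indepMH q w))^[k] (μ₀.map Prod.snd)) -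
        2 * ((1 - (w x₀)⁻¹) ^ k * (c - a) ^ 2 * w x₀) ≤
      ∫ z, (f ((z k).2) + ∑ n ∈ Finset.range N, (f ((z (k + n)).1) - f ((z (k + n)).2)) -
          ∫ x, f x ∂(q.withDensity fun y => ENNReal.ofReal (w y))) ^ 2
        ∂(Kernel.trajMeasure (X := fun _ : ℕ => Ω × Ω) μ₀
          (fun n : ℕ => Khat.comap (fun h : (i : ↥(Finset.Iic n)) → Ω × Ω => h ⟨n, Finset.mem_Iic.2 le_rfl⟩)
            (measurable_pi_apply _))) := by
  haveI : IsProbabilityMeasure (μ₀.map Prod.snd) := Measure.isProbabilityMeasure_map measurable_snd.aemeasurable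
  set P := Kernel.trajMeasure (X := fun _ : ℕ => Ω × Ω) μ₀
        (fun n : ℕ => Khat.comap (fun h : (i : ↥(Finset.Iic n)) → Ω × Ω => h ⟨n, Finset.mem_Iic.2 le_rfl⟩)
          (measurable_pi_apply _)) with hP
  set π : Measure Ω := q.withDensity fun y => ENNReal.ofReal (w y) with hπ
  set m : ℝ := ∫ x, f x ∂π with hm
  -- `m ∈ [a, c]`, so `|f − m| ≤ c − a`
  have hC : ∀ x, |f x| ≤ max |a| |c| := fun x => abs_le_max_abs_abs (ha x) (hc x)
  have hfi : Integrable f π := integrable_of_bounded π hf hC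
  have hma : a ≤ m := by
    have := integral_mono (integrable_const a) hfi ha; rwa [integral_const, probReal_univ, one_smul] at this
  have hmc : m ≤ c := by
    have := integral_mono hfi (integrable_const c) hc; rwa [integral_const, probReal_univ, one_smul] at this
  have hXb : ∀ y, |f y - m| ≤ c - a := fun y => by
    have h1 := ha y; have h2 := hc y
    exact abs_le.2 ⟨by linarith, by linarith⟩
  have hca : 0 ≤ c - a := by linarith
  have hW : 1 ≤ w x₀ := one_le_of_mode (q := q) hmax
  have hWpos : 0 < w x₀ := hw0 x₀
  have hr0 : 0 ≤ 1 - (w x₀)⁻¹ := sub_nonneg.2 (inv_le_one_of_one_le₀ hW)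
  have hr1 : 1 - (w x₀)⁻¹ < 1 := sub_lt_self _ (inv_pos.mpr hWpos)
  -- the three path functionals: `X = f(Y_k) − m`, `S = Σ D`, `T = Σ |D|`
  have hXm : Measurable (fun z : ℕ → Ω × Ω => f ((z k).2) - m) :=
    (hf.comp (measurable_snd.comp (measurable_pi_apply k))).sub measurable_const
  have hDm' : ∀ n, Measurable (fun z : ℕ → Ω × Ω => f ((z n).1) - f ((z n).2)) := fun n =>
    (hf.comp (measurable_fst.comp (measurable_pi_apply n))).sub (hf.comp (measurable_snd.comp (measurable_pi_apply n)))
  have hDb : ∀ n (z : ℕ → Ω × Ω), |f ((z n).1) - f ((z n).2)| ≤ c - a := by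
    intro n z
    have h1 := ha ((z n).1); have h2 := hc ((z n).1); have h3 := ha ((z n).2); have h4 := hc ((z n).2)
    exact abs_le.2 ⟨by linarith, by linarith⟩
  have hSm : Measurable (fun z : ℕ → Ω × Ω => ∑ n ∈ range N, (f ((z (k + n)).1) - f ((z (k + n)).2))) :=
    Finset.measurable_sum _ fun n _ => hDm' (k + n)
  have hTm : Measurable (fun z : ℕ → Ω × Ω => ∑ n ∈ range N, |f ((z (k + n)).1) - f ((z (k + n)).2)|) :=
    Finset.measurable_sum _ fun n _ => (hDm' (k + n)).abs
  have hST : ∀ z : ℕ → Ω × Ω, |∑ n ∈ range N, (f ((z (k + n)).1) - f ((z (k + n)).2))| ≤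
      ∑ n ∈ range N, |f ((z (k + n)).1) - f ((z (k + n)).2)| := fun z => abs_sum_le_sum_abs _ _
  have hTb : ∀ z : ℕ → Ω × Ω, ∑ n ∈ range N, |f ((z (k + n)).1) - f ((z (k + n)).2)| ≤ N * (c - a) := by
    intro z
    refine (sum_le_sum fun n _ => hDb (k + n) z).trans_eq ?_
    rw [sum_const, card_range, nsmul_eq_mul]
  have hTnn : ∀ z : ℕ → Ω × Ω, 0 ≤ ∑ n ∈ range N, |f ((z (k + n)).1) - f ((z (k + n)).2)| := fun z =>
    sum_nonneg fun n _ => abs_nonneg _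
  -- integrability of the pieces
  have hX2i : Integrable (fun z : ℕ → Ω × Ω => (f ((z k).2) - m) ^ 2) P :=
    integrable_of_bounded P (hXm.pow_const 2) (C := (c - a) ^ 2) (fun z => by
      rw [abs_pow]; exact pow_le_pow_left₀ (abs_nonneg _) (hXb _) 2)
  have hXTi : Integrable (fun z : ℕ → Ω × Ω =>
      |f ((z k).2) - m| * ∑ n ∈ range N, |f ((z (k + n)).1) - f ((z (k + n)).2)|) P :=
    integrable_of_bounded P (hXm.abs.mul hTm) (C := (c - a) * (N * (c - a))) (fun z => by
      rw [abs_mul, abs_abs, abs_of_nonneg (hTnn z)]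
      exact mul_le_mul (hXb _) (hTb z) (hTnn z) hca)
  have hLi : Integrable (fun z : ℕ → Ω × Ω =>
      (f ((z k).2) + ∑ n ∈ range N, (f ((z (k + n)).1) - f ((z (k + n)).2)) - m) ^ 2) P :=
    integrable_of_bounded P (((hf.comp (measurable_snd.comp (measurable_pi_apply k))).add hSm).sub
      measurable_const |>.pow_const 2) (C := ((c - a) + N * (c - a)) ^ 2) (fun z => by
      rw [abs_pow]
      refine pow_le_pow_left₀ (abs_nonneg _) ?_ 2
      have : f ((z k).2) + ∑ n ∈ range N, (f ((z (k + n)).1) - f ((z (k + n)).2)) - m =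
          (f ((z k).2) - m) + ∑ n ∈ range N, (f ((z (k + n)).1) - f ((z (k + n)).2)) := by ring
      rw [this]
      exact (abs_add_le _ _).trans (add_le_add (hXb _) ((hST z).trans (hTb z))))
  -- pointwise: `(X + S)² ≥ X² − 2|X|·T`
  have hpt : ∀ z : ℕ → Ω × Ω,
      (f ((z k).2) - m) ^ 2 - 2 * (|f ((z k).2) - m| * ∑ n ∈ range N, |f ((z (k + n)).1) - f ((z (k + n)).2)|) ≤
        (f ((z k).2) + ∑ n ∈ range N, (f ((z (k + n)).1) - f ((z (k + n)).2)) - m) ^ 2 := by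
    intro z
    have h1 : -((f ((z k).2) - m) * ∑ n ∈ range N, (f ((z (k + n)).1) - f ((z (k + n)).2))) ≤
        |f ((z k).2) - m| * ∑ n ∈ range N, |f ((z (k + n)).1) - f ((z (k + n)).2)| := by
      refine (neg_le_abs _).trans ?_
      rw [abs_mul]
      exact mul_le_mul_of_nonneg_left (hST z) (abs_nonneg _)
    nlinarith [h1, sq_nonneg (∑ n ∈ range N, (f ((z (k + n)).1) - f ((z (k + n)).2)))]
  have h12 : Integrable (fun z : ℕ → Ω × Ω => (f ((z k).2) - m) ^ 2 -
      2 * (|f ((z k).2) - m| * ∑ n ∈ range N, |f ((z (k + n)).1) - f ((z (k + n)).2)|)) P :=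
    hX2i.sub (hXTi.const_mul 2)
  -- the expectations
  have hE1 : ∫ z, (f ((z k).2) - m) ^ 2 ∂P =
      ∫ y, (f y - m) ^ 2 ∂((fun m : Measure Ω => m.bind (indepMH q w))^[k] (μ₀.map Prod.snd)) :=
    crnLag_integral_snd_eq hw0 Khat hK μ₀ (f := fun y => (f y - m) ^ 2) ((hf.sub measurable_const).pow_const 2)
      (C := (c - a) ^ 2) (fun y => by rw [abs_pow]; exact pow_le_pow_left₀ (abs_nonneg _) (hXb y) 2) k
  have hE2 : ∫ z, |f ((z k).2) - m| * ∑ n ∈ range N, |f ((z (k + n)).1) - f ((z (k + n)).2)| ∂P ≤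
      (1 - (w x₀)⁻¹) ^ k * (c - a) ^ 2 * w x₀ := by
    have hDi : ∀ n, Integrable (fun z : ℕ → Ω × Ω => |f ((z n).1) - f ((z n).2)|) P := fun n =>
      integrable_of_bounded P (hDm' n).abs (fun z => by rw [abs_abs]; exact hDb n z)
    calc ∫ z, |f ((z k).2) - m| * ∑ n ∈ range N, |f ((z (k + n)).1) - f ((z (k + n)).2)| ∂P
        ≤ ∫ z, (c - a) * ∑ n ∈ range N, |f ((z (k + n)).1) - f ((z (k + n)).2)| ∂P :=
          integral_mono hXTi ((integrable_finsetSum _ fun n _ => hDi (k + n)).const_mul _)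
            (fun z => mul_le_mul_of_nonneg_right (hXb _) (hTnn z))
      _ = (c - a) * ∑ n ∈ range N, ∫ z, |f ((z (k + n)).1) - f ((z (k + n)).2)| ∂P := by
          rw [integral_const_mul, integral_finsetSum _ fun n _ => hDi (k + n)]
      _ ≤ (c - a) * ∑ n ∈ range N, (1 - (w x₀)⁻¹) ^ (k + n) * (c - a) :=
          mul_le_mul_of_nonneg_left (sum_le_sum fun n _ =>
            crnLag_integral_abs_diff_le hw0 hmax Khat hK μ₀ hf ha hc (k + n)) hca
      _ = (1 - (w x₀)⁻¹) ^ k * (c - a) ^ 2 * ∑ n ∈ range N, (1 - (w x₀)⁻¹) ^ n := by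
          rw [mul_sum, mul_sum]
          refine sum_congr rfl fun n _ => ?_
          rw [pow_add]; ring
      _ ≤ (1 - (w x₀)⁻¹) ^ k * (c - a) ^ 2 * (1 - (1 - (w x₀)⁻¹))⁻¹ :=
          mul_le_mul_of_nonneg_left (sum_le_hasSum (range N) (fun n _ => pow_nonneg hr0 n)
            (hasSum_geometric_of_lt_one hr0 hr1)) (by positivity)
      _ = (1 - (w x₀)⁻¹) ^ k * (c - a) ^ 2 * w x₀ := by rw [sub_sub_cancel, inv_inv]
  calc ∫ y, (f y - m) ^ 2 ∂((fun m : Measure Ω => m.bind (indepMH q w))^[k] (μ₀.map Prod.snd)) -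
        2 * ((1 - (w x₀)⁻¹) ^ k * (c - a) ^ 2 * w x₀)
      ≤ ∫ z, (f ((z k).2) - m) ^ 2 ∂P -
          2 * ∫ z, |f ((z k).2) - m| * ∑ n ∈ range N, |f ((z (k + n)).1) - f ((z (k + n)).2)| ∂P := by
        rw [hE1]; linarith
    _ = ∫ z, ((f ((z k).2) - m) ^ 2 -
          2 * (|f ((z k).2) - m| * ∑ n ∈ range N, |f ((z (k + n)).1) - f ((z (k + n)).2)|)) ∂P := by
        rw [integral_sub hX2i (hXTi.const_mul 2), integral_const_mul]
    _ ≤ _ := integral_mono h12 hLi hpt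


/-- **`E(H_{k,N} − π f)² ≥ (1 − r^k)·Var_π f − 2r^k(c − a)²W`** from every initial coupling. [ours] -/
theorem crnLag_truncated_sq_ge_variance [Fact (Measurable w)] (hw0 : ∀ y, 0 < w y) {x₀ : Ω} (hmax : ∀ y, w y ≤ w x₀)
    [IsProbabilityMeasure (q.withDensity fun y => ENNReal.ofReal (w y))]
    (Khat : Kernel (Ω × Ω) (Ω × Ω)) [IsMarkovKernel Khat]
    (hK : ∀ z : Ω × Ω, Khat z = (q.prod (volume : Measure unitInterval)).map (fun p : Ω × unitInterval =>
      ((if (p.2 : ℝ) * w z.1 ≤ w p.1 then p.1 else z.1), (if (p.2 : ℝ) * w z.2 ≤ w p.1 then p.1 else z.2))))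
    (μ₀ : Measure (Ω × Ω)) [IsProbabilityMeasure μ₀] {f : Ω → ℝ} (hf : Measurable f) {a c : ℝ}
    (ha : ∀ x, a ≤ f x) (hc : ∀ x, f x ≤ c) (k N : ℕ) :
    (1 - (1 - (w x₀)⁻¹) ^ k) *
          ∫ y, (f y - ∫ x, f x ∂(q.withDensity fun y => ENNReal.ofReal (w y))) ^ 2
            ∂(q.withDensity fun y => ENNReal.ofReal (w y)) -
        2 * ((1 - (w x₀)⁻¹) ^ k * (c - a) ^ 2 * w x₀) ≤
      ∫ z, (f ((z k).2) + ∑ n ∈ Finset.range N, (f ((z (k + n)).1) - f ((z (k + n)).2)) -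
          ∫ x, f x ∂(q.withDensity fun y => ENNReal.ofReal (w y))) ^ 2
        ∂(Kernel.trajMeasure (X := fun _ : ℕ => Ω × Ω) μ₀
          (fun n : ℕ => Khat.comap (fun h : (i : ↥(Finset.Iic n)) → Ω × Ω => h ⟨n, Finset.mem_Iic.2 le_rfl⟩)
            (measurable_pi_apply _))) := by
  haveI : IsProbabilityMeasure (μ₀.map Prod.snd) := Measure.isProbabilityMeasure_map measurable_snd.aemeasurable
  have h1 := crnLag_truncated_sq_ge hw0 hmax Khat hK μ₀ hf ha hc k N
  obtain ⟨h2, -⟩ := integral_sq_sub_iterate_bind_indepMH_mem_Icc (q := q) Fact.out hw0 hmax k (μ₀.map Prod.snd) hf ha hc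
  linarith

/-- **THE TWO-SIDED CERTIFICATE**: `|E(H_{k,N} − π f)² − Var_π f| ≤ r^k·(c − a)²·(2W² + W + 1)` for every `k`, `N` and every
initial coupling. [ours] -/
theorem crnLag_truncated_sq_sub_variance_abs_le [Fact (Measurable w)] (hw0 : ∀ y, 0 < w y) {x₀ : Ω}
    (hmax : ∀ y, w y ≤ w x₀) [IsProbabilityMeasure (q.withDensity fun y => ENNReal.ofReal (w y))]
    (Khat : Kernel (Ω × Ω) (Ω × Ω)) [IsMarkovKernel Khat]
    (hK : ∀ z : Ω × Ω, Khat z = (q.prod (volume : Measure unitInterval)).map (fun p : Ω × unitInterval =>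
      ((if (p.2 : ℝ) * w z.1 ≤ w p.1 then p.1 else z.1), (if (p.2 : ℝ) * w z.2 ≤ w p.1 then p.1 else z.2))))
    (μ₀ : Measure (Ω × Ω)) [IsProbabilityMeasure μ₀] {f : Ω → ℝ} (hf : Measurable f) {a c : ℝ}
    (ha : ∀ x, a ≤ f x) (hc : ∀ x, f x ≤ c) (k N : ℕ) :
    |∫ z, (f ((z k).2) + ∑ n ∈ Finset.range N, (f ((z (k + n)).1) - f ((z (k + n)).2)) -
          ∫ x, f x ∂(q.withDensity fun y => ENNReal.ofReal (w y))) ^ 2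
        ∂(Kernel.trajMeasure (X := fun _ : ℕ => Ω × Ω) μ₀
          (fun n : ℕ => Khat.comap (fun h : (i : ↥(Finset.Iic n)) → Ω × Ω => h ⟨n, Finset.mem_Iic.2 le_rfl⟩)
            (measurable_pi_apply _))) -
      ∫ y, (f y - ∫ x, f x ∂(q.withDensity fun y => ENNReal.ofReal (w y))) ^ 2
          ∂(q.withDensity fun y => ENNReal.ofReal (w y))| ≤
      (1 - (w x₀)⁻¹) ^ k * (c - a) ^ 2 * (2 * w x₀ ^ 2 + w x₀ + 1) := by
  haveI : IsProbabilityMeasure (μ₀.map Prod.snd) := Measure.isProbabilityMeasure_map measurable_snd.aemeasurable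
  have hup := crnLag_truncated_sq_le_variance' hw0 hmax Khat hK μ₀ hf ha hc k N
  have hlo := crnLag_truncated_sq_ge_variance hw0 hmax Khat hK μ₀ hf ha hc k N
  -- `Var_π f ≤ D² ≤ (c − a)²` (the single-time envelope at `n = 0`, start `π`)
  obtain ⟨-, hV⟩ := integral_sq_sub_iterate_bind_indepMH_mem_Icc (q := q) Fact.out hw0 hmax 0
    (q.withDensity fun y => ENNReal.ofReal (w y)) hf ha hc
  simp only [pow_zero, sub_self, zero_mul, zero_add, one_mul, Function.iterate_zero, id_eq] at hV
  set π : Measure Ω := q.withDensity fun y => ENNReal.ofReal (w y) with hπ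
  set m : ℝ := ∫ x, f x ∂π with hm
  have hW : 1 ≤ w x₀ := one_le_of_mode (q := q) hmax
  have hr0 : 0 ≤ 1 - (w x₀)⁻¹ := sub_nonneg.2 (inv_le_one_of_one_le₀ hW)
  have hrk := pow_nonneg hr0 k
  have hC : ∀ x, |f x| ≤ max |a| |c| := fun x => abs_le_max_abs_abs (ha x) (hc x)
  have hfi : Integrable f π := integrable_of_bounded π hf hC
  have hma : a ≤ m := by
    have := integral_mono (integrable_const a) hfi ha; rwa [integral_const, probReal_univ, one_smul] at this
  have hmc : m ≤ c := by
    have := integral_mono hfi (integrable_const c) hc; rwa [integral_const, probReal_univ, one_smul] at this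
  have hD : max (m - a) (c - m) ^ 2 ≤ (c - a) ^ 2 := by
    refine pow_le_pow_left₀ (le_max_of_le_left (sub_nonneg.2 hma)) (max_le ?_ ?_) 2 <;> linarith
  have hV0 : 0 ≤ ∫ y, (f y - m) ^ 2 ∂π := integral_nonneg fun y => sq_nonneg _
  have hVc : ∫ y, (f y - m) ^ 2 ∂π ≤ (c - a) ^ 2 := hV.trans hD
  rw [abs_le]
  constructor
  · nlinarith [mul_le_mul_of_nonneg_left hVc hrk, mul_nonneg hrk hV0, mul_nonneg hrk (sq_nonneg (c - a)),
      mul_nonneg (mul_nonneg hrk (sq_nonneg (c - a))) (sub_nonneg.2 hW)]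
  · linarith

/-- **With the lag rule**: `log((2W² + W + 1)/ε) ≤ k·A ⇒ |E(H_{k,N} − π f)² − Var_π f| ≤ ε·(c − a)²`. [ours] -/
theorem crnLag_truncated_sq_sub_variance_abs_le_of_log_le [Fact (Measurable w)] (hw0 : ∀ y, 0 < w y) {x₀ : Ω}
    (hmax : ∀ y, w y ≤ w x₀) [IsProbabilityMeasure (q.withDensity fun y => ENNReal.ofReal (w y))]
    (Khat : Kernel (Ω × Ω) (Ω × Ω)) [IsMarkovKernel Khat]
    (hK : ∀ z : Ω × Ω, Khat z = (q.prod (volume : Measure unitInterval)).map (fun p : Ω × unitInterval =>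
      ((if (p.2 : ℝ) * w z.1 ≤ w p.1 then p.1 else z.1), (if (p.2 : ℝ) * w z.2 ≤ w p.1 then p.1 else z.2))))
    (μ₀ : Measure (Ω × Ω)) [IsProbabilityMeasure μ₀] {f : Ω → ℝ} (hf : Measurable f) {a c : ℝ}
    (ha : ∀ x, a ≤ f x) (hc : ∀ x, f x ≤ c) {k : ℕ} (N : ℕ) {ε : ℝ} (hε : 0 < ε)
    (hk : Real.log ((2 * w x₀ ^ 2 + w x₀ + 1) / ε) ≤ k * (w x₀)⁻¹) :
    |∫ z, (f ((z k).2) + ∑ n ∈ Finset.range N, (f ((z (k + n)).1) - f ((z (k + n)).2)) -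
          ∫ x, f x ∂(q.withDensity fun y => ENNReal.ofReal (w y))) ^ 2
        ∂(Kernel.trajMeasure (X := fun _ : ℕ => Ω × Ω) μ₀
          (fun n : ℕ => Khat.comap (fun h : (i : ↥(Finset.Iic n)) → Ω × Ω => h ⟨n, Finset.mem_Iic.2 le_rfl⟩)
            (measurable_pi_apply _))) -
      ∫ y, (f y - ∫ x, f x ∂(q.withDensity fun y => ENNReal.ofReal (w y))) ^ 2
          ∂(q.withDensity fun y => ENNReal.ofReal (w y))| ≤ ε * (c - a) ^ 2 := by
  have h := crnLag_truncated_sq_sub_variance_abs_le hw0 hmax Khat hK μ₀ hf ha hc k N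
  have hW : 1 ≤ w x₀ := one_le_of_mode (q := q) hmax
  have hWpos : 0 < w x₀ := hw0 x₀
  have hr0 : 0 ≤ 1 - (w x₀)⁻¹ := sub_nonneg.2 (inv_le_one_of_one_le₀ hW)
  have hCpos : 0 < 2 * w x₀ ^ 2 + w x₀ + 1 := by positivity
  have hrk : (1 - (w x₀)⁻¹) ^ k * (2 * w x₀ ^ 2 + w x₀ + 1) ≤ ε := by
    have h1 : (1 - (w x₀)⁻¹) ^ k ≤ Real.exp (-(k * (w x₀)⁻¹)) := by
      calc (1 - (w x₀)⁻¹) ^ k ≤ Real.exp (-(w x₀)⁻¹) ^ k := by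
            refine pow_le_pow_left₀ hr0 ?_ k
            have := Real.add_one_le_exp (-(w x₀)⁻¹)
            linarith
        _ = Real.exp (-(k * (w x₀)⁻¹)) := by rw [← Real.exp_nat_mul]; ring_nf
    have h2 : Real.exp (-(k * (w x₀)⁻¹)) ≤ ε / (2 * w x₀ ^ 2 + w x₀ + 1) := by
      calc Real.exp (-(k * (w x₀)⁻¹)) ≤ Real.exp (-Real.log ((2 * w x₀ ^ 2 + w x₀ + 1) / ε)) :=
            Real.exp_le_exp.2 (neg_le_neg hk)
        _ = ε / (2 * w x₀ ^ 2 + w x₀ + 1) := by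
            rw [Real.exp_neg, Real.exp_log (by positivity), inv_div]
    have := h1.trans h2
    rwa [le_div_iff₀ hCpos] at this
  nlinarith [sq_nonneg (c - a), mul_le_mul_of_nonneg_left hrk (sq_nonneg (c - a))]

end Summit.Ventures.LatticeQCDFlow.Exactness

end
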